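import Mathlib
import HarnessLib

/-!
# Ergodic reduction for the crux `AperiodicFrustratedLawGap` — a common a.e.-convergent subsequence

Route `FrustratedLawDichotomy`, crux `AperiodicFrustratedLawGap` (item `stmt-AtomisticToContinuum-27623`),
registered stub `stub_ergodicReduction` (skeleton `dd3251ad731e`); brick for step S2 of the `hErg` plan
(evidence `D5-PLAN.md`): the mean ergodic theorem (`…ErgodicMeanErgodic.meanErgodic_rerootAverage`) gives
`L²`-convergence of the Cesàro averages of COUNTABLY MANY test functions; step S2 needs ONE subsequence along
which all of them converge almost everywhere.  Generic measure theory: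

* `tendsto_of_tendsto_min_one` — if `min 1 (a k) → 0` in `ℝ≥0∞` then `a k → 0`;
* `exists_subseq_forall_ae_tendsto` — for a finite measure `ν` and countably many sequences `u j n → v j` in
  `L²(ν)` (`eLpNorm (u j n − v j) 2 ν → 0`), there is a strictly increasing `ns : ℕ → ℕ` with
  `u j (ns k) x → v j x` for `ν`-a.e. `x`, simultaneously for all `j` (fast subsequence + Borel–Cantelli type
  summation, no diagonal argument needed).

`[folklore]`.
-/

noncomputable section

namespace Summit.AtomisticToContinuum.Crystallization.Theorems.FrustratedLawDichotomyErgodicReduction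

open MeasureTheory Set Filter Topology
open scoped ENNReal

/-- If `min 1 (a k) → 0` in `ℝ≥0∞` then `a k → 0`. [folklore] -/
theorem tendsto_of_tendsto_min_one {a : ℕ → ℝ≥0∞} (h : Tendsto (fun k => min 1 (a k)) atTop (𝓝 0)) :
    Tendsto a atTop (𝓝 0) := by
  have hev : ∀ᶠ k in atTop, min 1 (a k) < 1 := (tendsto_order.1 h).2 1 one_pos
  refine h.congr' (hev.mono fun k hk => ?_)
  rcases min_lt_iff.1 hk with h1 | h1
  · exact absurd h1 (lt_irrefl 1)
  · exact min_eq_right h1.le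

/-- **One subsequence for countably many `L²`-convergent sequences.**  Let `ν` be a finite measure and, for
each `j : ℕ`, `u j n → v j` in `L²(ν)` (all functions measurable).  Then there is a strictly increasing
`ns : ℕ → ℕ` such that for `ν`-almost every `x`, `u j (ns k) x → v j x` for every `j`.  Proof: choose `ns k`
with `∫ min(1, |u j (ns k) − v j|) dν < 2^{-k}` for all `j ≤ k`; then for each `j` the errors along
`k ↦ ns (k + j)` are summable in `L¹`, hence summable almost everywhere, hence tend to `0`. [folklore] -/
theorem exists_subseq_forall_ae_tendsto {α : Type*} [MeasurableSpace α] {ν : Measure α} [IsFiniteMeasure ν]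
    {u : ℕ → ℕ → α → ℝ} {v : ℕ → α → ℝ} (hu : ∀ j n, Measurable (u j n)) (hv : ∀ j, Measurable (v j))
    (h : ∀ j, Tendsto (fun n => eLpNorm (u j n - v j) 2 ν) atTop (𝓝 0)) :
    ∃ ns : ℕ → ℕ, StrictMono ns ∧ ∀ᵐ x ∂ν, ∀ j, Tendsto (fun k => u j (ns k) x) atTop (𝓝 (v j x)) := by
  -- the truncated errors and their integrals
  set e : ℕ → ℕ → α → ℝ≥0∞ := fun j n x => min 1 ‖u j n x - v j x‖ₑ with he_def
  have he_meas : ∀ j n, Measurable (e j n) := fun j n =>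
    measurable_const.min ((hu j n).sub (hv j)).enorm
  set T : ℕ → ℕ → ℝ≥0∞ := fun j n => ∫⁻ x, e j n x ∂ν with hT_def
  have hT : ∀ j, Tendsto (T j) atTop (𝓝 0) := by
    intro j
    have hbound : ∀ n, T j n ≤ eLpNorm (u j n - v j) 2 ν * ν univ ^ (1 / (1 : ℝ≥0∞).toReal - 1 / (2 : ℝ≥0∞).toReal) := by
      intro n
      calc T j n ≤ ∫⁻ x, ‖(u j n - v j) x‖ₑ ∂ν := lintegral_mono fun x => min_le_right _ _
        _ = eLpNorm (u j n - v j) 1 ν := eLpNorm_one_eq_lintegral_enorm.symm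
        _ ≤ _ := eLpNorm_le_eLpNorm_mul_rpow_measure_univ (by norm_num)
            ((hu j n).sub (hv j)).aestronglyMeasurable
    have hlim : Tendsto (fun n => eLpNorm (u j n - v j) 2 ν *
        ν univ ^ (1 / (1 : ℝ≥0∞).toReal - 1 / (2 : ℝ≥0∞).toReal)) atTop (𝓝 0) := by
      have := ENNReal.Tendsto.mul_const (h j) (Or.inr (ENNReal.rpow_ne_top_of_nonneg
        (by norm_num : (0 : ℝ) ≤ 1 / (1 : ℝ≥0∞).toReal - 1 / (2 : ℝ≥0∞).toReal) (measure_ne_top ν univ)))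
      rwa [zero_mul] at this
    exact tendsto_of_tendsto_of_tendsto_of_le_of_le tendsto_const_nhds hlim (fun n => (zero_le : (0 : ℝ≥0∞) ≤ T j n)) hbound
  -- a fast subsequence, simultaneously for all `j ≤ k`
  have hev : ∀ k : ℕ, ∀ᶠ n in atTop, ∀ j ∈ Finset.range (k + 1), T j n < (2⁻¹ : ℝ≥0∞) ^ k := by
    intro k
    refine (Finset.eventually_all _).2 fun j _ => ?_
    exact (tendsto_order.1 (hT j)).2 _ (ENNReal.pow_pos (by norm_num) k)
  obtain ⟨ns, hns, hnsP⟩ := extraction_forall_of_eventually hev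
  refine ⟨ns, hns, ?_⟩
  rw [ae_all_iff]
  intro j
  -- along `k ↦ ns (k + j)` the truncated errors of index `j` are summable in `L¹`
  have hTk : ∀ k, T j (ns (k + j)) ≤ (2⁻¹ : ℝ≥0∞) ^ k := fun k => by
    have h1 := hnsP (k + j) j (Finset.mem_range.2 (by omega))
    exact h1.le.trans (pow_le_pow_right_of_le_one' (by norm_num) (by omega))
  have hsum : ∫⁻ x, ∑' k, e j (ns (k + j)) x ∂ν ≠ ∞ := by
    rw [lintegral_tsum fun k => (he_meas j (ns (k + j))).aemeasurable]
    refine ne_top_of_le_ne_top ?_ (ENNReal.tsum_le_tsum hTk)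
    rw [ENNReal.tsum_geometric]
    norm_num
  have hae := ae_lt_top (Measurable.tsum fun k => he_meas j (ns (k + j))) hsum
  filter_upwards [hae] with x hx
  have h0 : Tendsto (fun k => e j (ns (k + j)) x) atTop (𝓝 0) :=
    ENNReal.tendsto_atTop_zero_of_tsum_ne_top hx.ne
  have h1 : Tendsto (fun k => e j (ns k) x) atTop (𝓝 0) := (tendsto_add_atTop_iff_nat j).1 h0
  have h2 : Tendsto (fun k => ‖u j (ns k) x - v j x‖ₑ) atTop (𝓝 0) := tendsto_of_tendsto_min_one h1
  rw [tendsto_iff_edist_tendsto_0]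
  simpa only [edist_eq_enorm_sub] using h2

end Summit.AtomisticToContinuum.Crystallization.Theorems.FrustratedLawDichotomyErgodicReduction

end
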